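import Summits.QuantumFields.BalabanUV.Beta.D1BFx.NeedleNdlNdlLetters
import Summits.QuantumFields.BalabanUV.Beta.D1BFx.NeedleNdlShape
import Summits.QuantumFields.BalabanUV.Beta.D1BFx.NeedlePotentialProfile
import Summits.QuantumFields.BalabanUV.Beta.D1BFx.GhostLegBlockMass

/-!
# `BalabanUV.Beta.D1BFx.NeedleNdlNdlLetterForms` — road «BF-x» for binder row D1, slot (K), END row `hGrp gN`, «GN-33 ∕ NN» LETTER FORMS: the three
# letters of the `ndl ⊗ ndl` cell (needle potential gradient, combined-column gradient, gluon leg) AT A COMMON SITE-DAMPING RATE `ε ≤ native`, the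
# site ↔ block decay conversions at scale `n`, and the arithmetic of the HLS kit's brackets at `ε = δ∕n` (polynomial in `n`)

HONEST DEPENDENCY (cell records, verbatim): «continuum YM on T⁴ ⇐ BetaPertH ∧ nine spine estimates (0/9 proved); BetaPertH ⇐ (D1) ∧ (D4) ∧
CAP+tail; G-an2-4 gates asym, D1 and NE2/3/4.»  HONEST FRAMING (cell contract, verbatim): «discharging `BetaPertH` makes Bałaban's UV stability
UNCONDITIONAL — a real constructive-QFT result; it is NOT the continuum limit and NOT the Clay problem.»  THIS MODULE DISCHARGES NOTHING of the
wall: [folklore] bookkeeping BY NAME over `NeedlePotentialProfile.abs_ndlRow_diff_le_needle_profile` (kP, damped), `ProjectorColumnSharp.abs_combinedColumn_diff_le_sup`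
(C₀∕n, block decay), `RColumnProfile.nrm_sub_le`, `B6QGQDecay237.dist_blk_ge`, `GhostLegBlockMass.dist_eq_supNorm`; the gluon leg's damped entry profile
`kG·e^{−(δG∕n)‖y−x‖}∕nrm(y−x)²` is a HYPOTHESIS of `abs_Ga_le_of_profile` (supplied modulo [B5, Prop. 1.2] ∧ [B5, (1.126)–(1.127)] by leaf-04-g9's
`GluonLegProfile.exists_abs_Ga_le_profile` in the cell file).  No `def`, no `def … : Prop`, nothing cited, 0 sorry.  Root-level binders hW ∕ hR-sockets ∕
hSX-socket ∕ D1Tel ∕ D1Rep — 0 discharged; (K) NOT closed; NOT D1, NOT `BetaPertH`, NOT continuum, NOT Clay.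

ABSOLUTE RULE (cell charter, verbatim): «No internally-minted statement may enter as a cited fact. Every hypothesis is either kernel-proved in
this package or a verbatim quotation of a PUBLISHED theorem with page reference. The manuscript(s) under audit are NOT citable for their own
disputed steps — they are the thing under adjudication; programme-internal (2001/route/tribunal) claims are never citable.»

WHY (owner claim table «GN-CELLS» v0.2, R3 cell `ndl ⊗ ndl`; an3-g57 §3′ (4) R3⊗R3; MINE journal 2026-08-21 l.30734).  The abstract pairing letters of
`NeedleNdlNdlLetters` take ONE damping rate `ε` for all three factors; the tree's letters carry `dR∕(2n)` (R-column), `δG∕n` (leg), block decay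
`min(δ_PP, δ_P)` (combined column).  This file puts them at the common rate `δ∕n`, `δ := min (dR a∕2) (min δG (min δ_PP δ_P))`, converts block decay to
site damping for the column (`e^{−δ·dist(blk q, blk u)} ≤ e^{δ}·e^{−(δ∕n)‖q−u‖}`) and site damping back to block decay for the outputs (`dist_blk_ge`), and
records that the kit's brackets at `ε = δ∕n` are `≤ c(δ)·n^k` (`k = 2, 1, 3, 4, 1`) — the n-powers that cancel in `NeedleNdlNdlPairings`.

CONTENT (`a > 0`, `n ≥ 1`; the combined column spelled out as `q ↦ cQ·Σ_{z∈B(blk u)} Pgt n a z q − kerP (n−1) a q (blk u)`).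
* §1 [folklore] `one_add_le_mul_pow`, `c2_le` (`≤ c·n²`), `c3_le` (`≤ c·n`), `c1_le` (`≤ c·n³`), `c0_le` (`≤ c·n⁴`), `cg_le` (`≤ c·n`).
* §2 [folklore] **`abs_grad_ndlRow_le`** (needle-weighted damped cubic profile `kP∕n²`, any `ε ≤ dR∕(2n)`), `exp_blk_le_exp_site`, **`exp_site_le_exp_blk`**,
  **`abs_grad_col_le`** (flat damped `((|cQ|cPPs + cPs)·e^{δ_C}∕n)·e^{−ε‖q−u‖}`, any `ε ≤ δ_C∕n`), **`abs_Ga_le_of_profile`** (kit orientation, any `ε ≤ δG∕n`).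
NOT HERE (honest): the pairings (`NeedleNdlNdlPairings`), the word, the census, the cell (`NeedleNdlNdlRow`).
Unit `b2b-balaban-gan24-formalise-leaf-05` (gen 42), G-an2-4 swarm leaf prover on cross-lane kernel duty; `LEAVES-BFx.md` row (N) «GN-33∕NN».
-/

noncomputable section

namespace Summit.QuantumFields.BalabanUV.Beta.D1BFx.NeedleNdlNdlLetterForms

open Finset
open scoped BigOperators
open Literature.MathematicalPhysics.QuantumFieldTheory.Balaban1983to89
open Literature.MathematicalPhysics.QuantumFieldTheory.Balaban1983to89.Beta
open B6QGQLower276 (X e blk B mem_B)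
open B6QGQDecay237 (dist_blk_ge)
open ExpKernelCalculus (Site MKer)
open Beta.PoissonInterior (nrm nrm_pos nrm_neg supNorm_neg supNorm_le_nrm)
open DyadicShell (Pt)
open AffineAveraging (unitVec)
open Summit.QuantumFields.BalabanUV.Beta.D1BFx.RProjector (Pgt kerP deltaPP deltaP deltaPP_pos deltaP_pos)
open Summit.QuantumFields.BalabanUV.Beta.D1BFx.ProjectorSupNorm (cPPs cPs cPPs_nonneg cPs_nonneg)
open Summit.QuantumFields.BalabanUV.Beta.D1BFx.ProjectorColumnSharp (abs_combinedColumn_diff_le_sup)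
open Summit.QuantumFields.BalabanUV.Beta.D1BFx.GluonLeg (Ga)
open Summit.QuantumFields.BalabanUV.Beta.D1BFx.GhostStencil (qJet)
open Summit.QuantumFields.BalabanUV.Beta.D1BFx.NeedlePotentialLetters (ndlRow)
open Summit.QuantumFields.BalabanUV.Beta.D1BFx.NeedlePotentialProfile (abs_ndlRow_diff_le_needle_profile)
open Summit.QuantumFields.BalabanUV.Beta.D1BFx.RColumnBlockMass (dR dR_pos)
open Summit.QuantumFields.BalabanUV.Beta.D1BFx.RColumnProfile (kP kV_nonneg_and nrm_sub_le)
open Summit.QuantumFields.BalabanUV.Beta.D1BFx.GhostLegFree (supNorm_eq)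
open Summit.QuantumFields.BalabanUV.Beta.D1BFx.GhostLegBlockMass (dist_eq_supNorm)
open Summit.QuantumFields.BalabanUV.Beta.D1BFx.RankOneBubble (pairing applyK)
open Summit.QuantumFields.BalabanUV.Beta.D1BFx.RankOneBubbleJets (grad grad_apply)

/-! ## §1 The kit brackets at `ε = δ∕n` are polynomial in `n` -/

section Brackets

variable {δ : ℝ} {n : ℕ}

/-- [folklore] `1 + X ≤ (1 + A)·n^k` when `X ≤ A·n^k`, `n ≥ 1`. -/
theorem one_add_le_mul_pow {X A : ℝ} (hn : 1 ≤ n) (k : ℕ) (hX : X ≤ A * (n : ℝ) ^ k) :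
    1 + X ≤ (1 + A) * (n : ℝ) ^ k := by
  have hn1 : (1 : ℝ) ≤ n := by exact_mod_cast hn
  have hk : (1 : ℝ) ≤ (n : ℝ) ^ k := one_le_pow₀ hn1
  nlinarith

/-- [folklore] the exponent-2 flat bracket at `ε = δ∕n`: `1 + 216·(1!·(2∕(ε∕2))·(1 + 2∕(ε∕2))) ≤ (1 + 216·(4∕δ)(1+4∕δ))·n²`. -/
theorem c2_le (hδ : 0 < δ) (hn : 1 ≤ n) :
    1 + 2 * 4 * 3 ^ (4 - 1) * ((4 - 1 - 2).factorial * (2 / (δ / n / 2)) ^ (4 - 1 - 2) * (1 + 2 / (δ / n / 2)))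
      ≤ (1 + 2 * 4 * 3 ^ (4 - 1) * (4 / δ * (1 + 4 / δ))) * (n : ℝ) ^ 2 := by
  have hn1 : (1 : ℝ) ≤ n := by exact_mod_cast hn
  have e1 : (2 : ℝ) / (δ / n / 2) = 4 / δ * n := by field_simp; ring
  have e2 : ((4 - 1 - 2).factorial : ℝ) = 1 := by norm_num [Nat.factorial]
  rw [e2, show (4 - 1 - 2 : ℕ) = 1 by norm_num, pow_one, e1, one_mul]
  refine one_add_le_mul_pow hn 2 ?_
  have h4 : 0 ≤ 4 / δ := by positivity
  have : 1 + 4 / δ * n ≤ (1 + 4 / δ) * n := by nlinarith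
  calc (2 : ℝ) * 4 * 3 ^ (4 - 1) * (4 / δ * n * (1 + 4 / δ * n)) ≤ 2 * 4 * 3 ^ (4 - 1) * (4 / δ * n * ((1 + 4 / δ) * n)) := by gcongr
    _ = 2 * 4 * 3 ^ (4 - 1) * (4 / δ * (1 + 4 / δ)) * (n : ℝ) ^ 2 := by ring

/-- [folklore] the exponent-3 flat bracket at rate `ε∕2`, `ε = δ∕n`: `1 + 216·(0!·1·(1 + 2∕(ε∕4))) ≤ (1 + 216·(1+8∕δ))·n`. -/
theorem c3_le (hδ : 0 < δ) (hn : 1 ≤ n) :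
    1 + 2 * 4 * 3 ^ (4 - 1) * ((4 - 1 - 3).factorial * (2 / (δ / n / 2 / 2)) ^ (4 - 1 - 3) * (1 + 2 / (δ / n / 2 / 2)))
      ≤ (1 + 2 * 4 * 3 ^ (4 - 1) * (1 + 8 / δ)) * (n : ℝ) ^ 1 := by
  have hn1 : (1 : ℝ) ≤ n := by exact_mod_cast hn
  have e1 : (2 : ℝ) / (δ / n / 2 / 2) = 8 / δ * n := by field_simp; ring
  have e2 : ((4 - 1 - 3).factorial : ℝ) = 1 := by norm_num [Nat.factorial]
  rw [e2, show (4 - 1 - 3 : ℕ) = 0 by norm_num, pow_zero, e1, one_mul, one_mul]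
  refine one_add_le_mul_pow hn 1 ?_
  have h8 : 0 ≤ 8 / δ := by positivity
  rw [pow_one]
  nlinarith

/-- [folklore] the exponent-1 flat bracket at `ε = δ∕n`: `1 + 216·(2!·(2∕(ε∕2))²·(1 + 2∕(ε∕2))) ≤ (1 + 216·2·(4∕δ)²(1+4∕δ))·n³`. -/
theorem c1_le (hδ : 0 < δ) (hn : 1 ≤ n) :
    1 + 2 * 4 * 3 ^ (4 - 1) * ((4 - 1 - 1).factorial * (2 / (δ / n / 2)) ^ (4 - 1 - 1) * (1 + 2 / (δ / n / 2)))
      ≤ (1 + 2 * 4 * 3 ^ (4 - 1) * (2 * (4 / δ) ^ 2 * (1 + 4 / δ))) * (n : ℝ) ^ 3 := by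
  have hn1 : (1 : ℝ) ≤ n := by exact_mod_cast hn
  have e1 : (2 : ℝ) / (δ / n / 2) = 4 / δ * n := by field_simp; ring
  have e2 : ((4 - 1 - 1).factorial : ℝ) = 2 := by norm_num [Nat.factorial]
  rw [e2, show (4 - 1 - 1 : ℕ) = 2 by norm_num, e1]
  refine one_add_le_mul_pow hn 3 ?_
  have h4 : 0 ≤ 4 / δ := by positivity
  have : 1 + 4 / δ * n ≤ (1 + 4 / δ) * n := by nlinarith
  calc (2 : ℝ) * 4 * 3 ^ (4 - 1) * (2 * (4 / δ * n) ^ 2 * (1 + 4 / δ * n))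
      ≤ 2 * 4 * 3 ^ (4 - 1) * (2 * (4 / δ * n) ^ 2 * ((1 + 4 / δ) * n)) := by gcongr
    _ = 2 * 4 * 3 ^ (4 - 1) * (2 * (4 / δ) ^ 2 * (1 + 4 / δ)) * (n : ℝ) ^ 3 := by ring

/-- [folklore] the exponent-0 flat bracket at rate `ε∕2`, `ε = δ∕n`: `1 + 216·(3!·(2∕(ε∕4))³·(1 + 2∕(ε∕4))) ≤ (1 + 216·6·(8∕δ)³(1+8∕δ))·n⁴`. -/
theorem c0_le (hδ : 0 < δ) (hn : 1 ≤ n) :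
    1 + 2 * 4 * 3 ^ (4 - 1) * ((4 - 1 - 0).factorial * (2 / (δ / n / 2 / 2)) ^ (4 - 1 - 0) * (1 + 2 / (δ / n / 2 / 2)))
      ≤ (1 + 2 * 4 * 3 ^ (4 - 1) * (6 * (8 / δ) ^ 3 * (1 + 8 / δ))) * (n : ℝ) ^ 4 := by
  have hn1 : (1 : ℝ) ≤ n := by exact_mod_cast hn
  have e1 : (2 : ℝ) / (δ / n / 2 / 2) = 8 / δ * n := by field_simp; ring
  have e2 : ((4 - 1 - 0).factorial : ℝ) = 6 := by norm_num [Nat.factorial]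
  rw [e2, show (4 - 1 - 0 : ℕ) = 3 by norm_num, e1]
  refine one_add_le_mul_pow hn 4 ?_
  have h8 : 0 ≤ 8 / δ := by positivity
  have : 1 + 8 / δ * n ≤ (1 + 8 / δ) * n := by nlinarith
  calc (2 : ℝ) * 4 * 3 ^ (4 - 1) * (6 * (8 / δ * n) ^ 3 * (1 + 8 / δ * n))
      ≤ 2 * 4 * 3 ^ (4 - 1) * (6 * (8 / δ * n) ^ 3 * ((1 + 8 / δ) * n)) := by gcongr
    _ = 2 * 4 * 3 ^ (4 - 1) * (6 * (8 / δ) ^ 3 * (1 + 8 / δ)) * (n : ℝ) ^ 4 := by ring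

/-- [folklore] the gain bracket at `ε = δ∕n`: `217·29·(1 + 2n∕δ) ≤ 217·29·(1+2∕δ)·n`. -/
theorem cg_le (hδ : 0 < δ) (hn : 1 ≤ n) :
    (1 + 2 * 4 * 3 ^ (4 - 1)) * (2 + 3 ^ (4 - 1)) * (1 + 2 / (δ / n))
      ≤ (1 + 2 * 4 * 3 ^ (4 - 1)) * (2 + 3 ^ (4 - 1)) * (1 + 2 / δ) * (n : ℝ) ^ 1 := by
  have hn1 : (1 : ℝ) ≤ n := by exact_mod_cast hn
  have e1 : (2 : ℝ) / (δ / n) = 2 / δ * n := by field_simp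
  rw [e1, pow_one]
  have h2 : 0 ≤ 2 / δ := by positivity
  have : 1 + 2 / δ * n ≤ (1 + 2 / δ) * n := by nlinarith
  calc ((1 : ℝ) + 2 * 4 * 3 ^ (4 - 1)) * (2 + 3 ^ (4 - 1)) * (1 + 2 / δ * n)
      ≤ (1 + 2 * 4 * 3 ^ (4 - 1)) * (2 + 3 ^ (4 - 1)) * ((1 + 2 / δ) * n) := by gcongr
    _ = _ := by ring

end Brackets

/-! ## §2 The three letters at a common rate -/

variable (n : ℕ) [NeZero n] {a : ℝ} (cQ : ℝ)

/-- [folklore] **THE NEEDLE POTENTIAL's GRADIENT AS A NEEDLE-WEIGHTED DAMPED CUBIC PROFILE AT ANY RATE `ε ≤ dR∕(2n)`**: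
`|grad (ndlRow n a κ u) x c| ≤ Σ_{s∈B(blk u)} |qJet_u s|·((kP∕n²)·e^{−ε‖x−s‖}∕nrm(x−s)³)`. -/
theorem abs_grad_ndlRow_le (ha : 0 < a) {ε : ℝ} (hε : ε ≤ dR a / 2 / n) (κ : Fin 4) (u x : Site 4) (c : Fin 4) :
    |grad (ndlRow n a κ u) x c| ≤ ∑ s ∈ B (n - 1) (blk (n - 1) u), |qJet n κ u (blk (n - 1) u) s| *
      (kP a / (n : ℝ) ^ 2 * Real.exp (-ε * Beta.PoissonInterior.supNorm (x - s)) / nrm (x - s) ^ 3) := by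
  rw [grad_apply]
  refine (abs_ndlRow_diff_le_needle_profile n κ u ha x c).trans (Finset.sum_le_sum fun s _ => ?_)
  have hkP := (kV_nonneg_and ha).2
  have hn : (0 : ℝ) < n := by exact_mod_cast Nat.pos_of_ne_zero (NeZero.ne n)
  have hnrm := nrm_pos (x - s)
  refine mul_le_mul_of_nonneg_left ?_ (abs_nonneg _)
  refine div_le_div_of_nonneg_right (mul_le_mul_of_nonneg_left (Real.exp_le_exp.2 ?_) (by positivity)) (by positivity)
  have h0 : (0 : ℝ) ≤ Beta.PoissonInterior.supNorm (x - s) := Nat.cast_nonneg _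
  nlinarith

/-- [folklore] **SITE DAMPING AT SCALE `n` FROM BLOCK DECAY**: `e^{−δ·dist(blk q, blk u)} ≤ e^{δ}·e^{−ε‖q−u‖∞}` for `0 ≤ ε ≤ δ∕n`
(`‖q−u‖∞ ≤ nrm(q−u) ≤ n·(dist(blk q, blk u) + 1)`, `RColumnProfile.nrm_sub_le`). -/
theorem exp_blk_le_exp_site {δ ε : ℝ} (hδ : 0 ≤ δ) (hε : ε ≤ δ / n) (q u : Site 4) :
    Real.exp (-(δ * dist (blk (n - 1) q) (blk (n - 1) u))) ≤ Real.exp δ * Real.exp (-ε * Beta.PoissonInterior.supNorm (q - u)) := by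
  have hn : (0 : ℝ) < n := by exact_mod_cast Nat.pos_of_ne_zero (NeZero.ne n)
  rw [← Real.exp_add]
  apply Real.exp_le_exp.2
  have h1 : (Beta.PoissonInterior.supNorm (q - u) : ℝ) ≤ (n : ℝ) * (dist (blk (n - 1) q) (blk (n - 1) u) + 1) :=
    (supNorm_le_nrm (q - u)).trans (nrm_sub_le n q u)
  have hD : 0 ≤ dist (blk (n - 1) q) (blk (n - 1) u) := dist_nonneg
  have h2 : ε * (Beta.PoissonInterior.supNorm (q - u) : ℝ) ≤ δ / n * ((n : ℝ) * (dist (blk (n - 1) q) (blk (n - 1) u) + 1)) :=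
    mul_le_mul hε h1 (Nat.cast_nonneg _) (by positivity)
  have e : δ / n * ((n : ℝ) * (dist (blk (n - 1) q) (blk (n - 1) u) + 1)) = δ * dist (blk (n - 1) q) (blk (n - 1) u) + δ := by
    field_simp
  linarith

/-- [folklore] **BLOCK DECAY FROM SITE DAMPING AT SCALE `n`** (the converse direction, `B6QGQDecay237.dist_blk_ge`): for `s ∈ B(blk p)`,
`e^{−(δ∕n)‖s−u‖∞} ≤ e^{δ}·e^{−δ·dist(blk p, blk u)}` (`0 ≤ δ`). -/
theorem exp_site_le_exp_blk {δ : ℝ} (hδ : 0 ≤ δ) {p s : Site 4} (hs : s ∈ B (n - 1) (blk (n - 1) p)) (u : Site 4) :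
    Real.exp (-(δ / n) * Beta.PoissonInterior.supNorm (s - u)) ≤ Real.exp δ * Real.exp (-(δ * dist (blk (n - 1) p) (blk (n - 1) u))) := by
  have hn : (0 : ℝ) < n := by exact_mod_cast Nat.pos_of_ne_zero (NeZero.ne n)
  have hmn : (((n - 1 : ℕ) : ℝ) + 1) = n := GhostLeg.cast_pred_add_one n
  have h := dist_blk_ge hs (mem_B.2 (rfl : blk (n - 1) u = blk (n - 1) u))
  rw [hmn, dist_eq_supNorm s u] at h
  -- `h : n·D − (n−1) ≤ ‖s−u‖∞`
  have hsup : (DyadicShell.supNorm (s - u) : ℝ) = (Beta.PoissonInterior.supNorm (s - u) : ℝ) := by rw [supNorm_eq]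
  rw [hsup] at h
  have hm1 : ((n - 1 : ℕ) : ℝ) ≤ n := by linarith
  rw [← Real.exp_add]
  apply Real.exp_le_exp.2
  have hD : 0 ≤ dist (blk (n - 1) p) (blk (n - 1) u) := dist_nonneg
  have h2 : δ / n * ((n : ℝ) * dist (blk (n - 1) p) (blk (n - 1) u) - ((n - 1 : ℕ) : ℝ)) ≤ δ / n * (Beta.PoissonInterior.supNorm (s - u) : ℝ) :=
    mul_le_mul_of_nonneg_left h (by positivity)
  have e : δ / n * ((n : ℝ) * dist (blk (n - 1) p) (blk (n - 1) u) - ((n - 1 : ℕ) : ℝ)) =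
      δ * dist (blk (n - 1) p) (blk (n - 1) u) - δ * (((n - 1 : ℕ) : ℝ) / n) := by field_simp
  have h3 : δ * (((n - 1 : ℕ) : ℝ) / n) ≤ δ := by
    have : ((n - 1 : ℕ) : ℝ) / n ≤ 1 := by rw [div_le_one hn]; exact hm1
    nlinarith
  nlinarith

/-- [folklore] **THE COMBINED COLUMN's GRADIENT IS FLAT, DAMPED AT SCALE `n`** (any rate `ε ≤ min(δ_PP, δ_P)∕n`):
`|grad C_u q c| ≤ ((|cQ|·cPPs + cPs)·e^{min(δ_PP,δ_P)}∕n)·e^{−ε‖q−u‖∞}` (`ProjectorColumnSharp.abs_combinedColumn_diff_le_sup` + `exp_blk_le_exp_site`). -/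
theorem abs_grad_col_le (ha : 0 < a) {ε : ℝ} (hε : ε ≤ min (deltaPP 4 a) (deltaP 4 a) / n) (u q : Site 4) (c : Fin 4) :
    |grad (fun q => cQ * (∑ z ∈ B (n - 1) (blk (n - 1) u), Pgt n a z q () ()) - kerP (d := 4) (n - 1) a q (blk (n - 1) u)) q c|
      ≤ (|cQ| * cPPs 4 a + cPs 4 a) * Real.exp (min (deltaPP 4 a) (deltaP 4 a)) / (n : ℝ) * Real.exp (-ε * Beta.PoissonInterior.supNorm (q - u)) := by
  have hn : (0 : ℝ) < n := by exact_mod_cast Nat.pos_of_ne_zero (NeZero.ne n)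
  have hPP := deltaPP_pos 4 ha; have hP := deltaP_pos 4 ha
  set δ := min (deltaPP 4 a) (deltaP 4 a) with hδ
  have hδ0 : 0 < δ := lt_min hPP hP
  rw [grad_apply, show (unitVec c : Site 4) = e c from rfl]
  refine (abs_combinedColumn_diff_le_sup n ha cQ q (blk (n - 1) u) c () ()).trans ?_
  set D := dist (blk (n - 1) q) (blk (n - 1) u) with hD
  have hD0 : 0 ≤ D := dist_nonneg
  have e1 : Real.exp (-(deltaPP 4 a * dist (blk (n - 1) u) (blk (n - 1) q))) ≤ Real.exp (-(δ * D)) := by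
    rw [dist_comm]; exact Real.exp_le_exp.2 (by nlinarith [min_le_left (deltaPP 4 a) (deltaP 4 a)])
  have e2 : Real.exp (-(deltaP 4 a * D)) ≤ Real.exp (-(δ * D)) :=
    Real.exp_le_exp.2 (by nlinarith [min_le_right (deltaPP 4 a) (deltaP 4 a)])
  have e3 := exp_blk_le_exp_site n hδ0.le hε q u
  have hPPs := cPPs_nonneg 4 ha
  have hc1 : 0 ≤ |cQ| * cPPs 4 a := mul_nonneg (abs_nonneg _) hPPs
  have hc2 := cPs_nonneg 4 ha
  calc |cQ| * (cPPs 4 a / (n : ℝ) * Real.exp (-(deltaPP 4 a * dist (blk (n - 1) u) (blk (n - 1) q))))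
        + cPs 4 a / (n : ℝ) * Real.exp (-(deltaP 4 a * D))
      ≤ |cQ| * (cPPs 4 a / (n : ℝ) * Real.exp (-(δ * D))) + cPs 4 a / (n : ℝ) * Real.exp (-(δ * D)) := by gcongr
    _ = (|cQ| * cPPs 4 a + cPs 4 a) / (n : ℝ) * Real.exp (-(δ * D)) := by ring
    _ ≤ (|cQ| * cPPs 4 a + cPs 4 a) / (n : ℝ) * (Real.exp δ * Real.exp (-ε * Beta.PoissonInterior.supNorm (q - u))) :=
        mul_le_mul_of_nonneg_left e3 (by positivity)
    _ = _ := by ring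

/-- [folklore] **THE LEG's DAMPED ENTRY PROFILE IN THE KIT's ORIENTATION AT ANY RATE `ε ≤ δG∕n`**: from
`|Ga n a x y κ l| ≤ kG·e^{−(δG∕n)‖y−x‖}∕nrm(y−x)²` to `|Ga n a x y κ l| ≤ kG·e^{−ε‖x−y‖}∕nrm(x−y)²`. -/
theorem abs_Ga_le_of_profile {kG δG ε : ℝ} (hkG : 0 ≤ kG) (hε : ε ≤ δG / n)
    (hG : ∀ (x y : Pt) (κ l : Fin 4), |Ga n a x y κ l| ≤ kG * Real.exp (-(δG / n) * Beta.PoissonInterior.supNorm (y - x)) / nrm (y - x) ^ 2)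
    (x y : Site 4) (κ l : Fin 4) :
    |Ga n a x y κ l| ≤ kG * Real.exp (-ε * Beta.PoissonInterior.supNorm (x - y)) / nrm (x - y) ^ 2 := by
  refine (hG x y κ l).trans ?_
  rw [← nrm_neg (x - y), neg_sub, ← supNorm_neg (x - y), neg_sub]
  have hnrm := nrm_pos (y - x)
  refine div_le_div_of_nonneg_right (mul_le_mul_of_nonneg_left (Real.exp_le_exp.2 ?_) hkG) (by positivity)
  have h0 : (0 : ℝ) ≤ Beta.PoissonInterior.supNorm (y - x) := Nat.cast_nonneg _
  nlinarith

end Summit.QuantumFields.BalabanUV.Beta.D1BFx.NeedleNdlNdlLetterForms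

end
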